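import Summits.Ventures.PercRepro.RankLevelSetRuleQSliceBottomCrude

/-!
# PercRepro — THE WHOLE BOTTOM REGIME OF `k = 12` (night-1, gen 20; dossier §31.13)

`bottom_k12_complete (q) (11 ≤ q) (q ≤ 53) : phiK (q + 12) q ≤ rhat q 12 (q − 10)`: `m = 1` by `rhatCell_one`, `m = 2` by
`phiK_le_rhat_flat_two`, `3 ≤ m ≤ 27` by the crude chain (`bottom_k12_all`), `28 ≤ m ≤ 43` by the fine bound (the sixteen cells
`bottom_k12_d26` … `bottom_k12_d41`, each a `norm_num` evaluation of `B_fine(10, d)` with the binomial ratios through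
`Nat.choose_eq_descFactorial_div_factorial`). Axioms: standard.
-/

namespace PercRepro

open Finset

/-- The bottom cell `k = 12`, `m = 28` (`d = 26`), by the fine bound. -/
theorem bottom_k12_d26 : phiK (2 + 26 + 10 + (10 + 2)) (2 + 26 + 10) ≤ rhat (2 + 26 + 10) (10 + 2) (2 + 26) := by
  apply phiK_le_rhat_bottom_of_fine 10 26 (by norm_num)
  simp only [Finset.sum_range_succ, Finset.sum_range_zero, Finset.prod_range_succ, Finset.prod_range_zero,
    Nat.choose_eq_descFactorial_div_factorial]
  norm_num [Nat.descFactorial, Nat.factorial]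

/-- The bottom cell `k = 12`, `m = 29` (`d = 27`), by the fine bound. -/
theorem bottom_k12_d27 : phiK (2 + 27 + 10 + (10 + 2)) (2 + 27 + 10) ≤ rhat (2 + 27 + 10) (10 + 2) (2 + 27) := by
  apply phiK_le_rhat_bottom_of_fine 10 27 (by norm_num)
  simp only [Finset.sum_range_succ, Finset.sum_range_zero, Finset.prod_range_succ, Finset.prod_range_zero,
    Nat.choose_eq_descFactorial_div_factorial]
  norm_num [Nat.descFactorial, Nat.factorial]

/-- The bottom cell `k = 12`, `m = 30` (`d = 28`), by the fine bound. -/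
theorem bottom_k12_d28 : phiK (2 + 28 + 10 + (10 + 2)) (2 + 28 + 10) ≤ rhat (2 + 28 + 10) (10 + 2) (2 + 28) := by
  apply phiK_le_rhat_bottom_of_fine 10 28 (by norm_num)
  simp only [Finset.sum_range_succ, Finset.sum_range_zero, Finset.prod_range_succ, Finset.prod_range_zero,
    Nat.choose_eq_descFactorial_div_factorial]
  norm_num [Nat.descFactorial, Nat.factorial]

/-- The bottom cell `k = 12`, `m = 31` (`d = 29`), by the fine bound. -/
theorem bottom_k12_d29 : phiK (2 + 29 + 10 + (10 + 2)) (2 + 29 + 10) ≤ rhat (2 + 29 + 10) (10 + 2) (2 + 29) := by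
  apply phiK_le_rhat_bottom_of_fine 10 29 (by norm_num)
  simp only [Finset.sum_range_succ, Finset.sum_range_zero, Finset.prod_range_succ, Finset.prod_range_zero,
    Nat.choose_eq_descFactorial_div_factorial]
  norm_num [Nat.descFactorial, Nat.factorial]

/-- The bottom cell `k = 12`, `m = 32` (`d = 30`), by the fine bound. -/
theorem bottom_k12_d30 : phiK (2 + 30 + 10 + (10 + 2)) (2 + 30 + 10) ≤ rhat (2 + 30 + 10) (10 + 2) (2 + 30) := by
  apply phiK_le_rhat_bottom_of_fine 10 30 (by norm_num)
  simp only [Finset.sum_range_succ, Finset.sum_range_zero, Finset.prod_range_succ, Finset.prod_range_zero,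
    Nat.choose_eq_descFactorial_div_factorial]
  norm_num [Nat.descFactorial, Nat.factorial]

/-- The bottom cell `k = 12`, `m = 33` (`d = 31`), by the fine bound. -/
theorem bottom_k12_d31 : phiK (2 + 31 + 10 + (10 + 2)) (2 + 31 + 10) ≤ rhat (2 + 31 + 10) (10 + 2) (2 + 31) := by
  apply phiK_le_rhat_bottom_of_fine 10 31 (by norm_num)
  simp only [Finset.sum_range_succ, Finset.sum_range_zero, Finset.prod_range_succ, Finset.prod_range_zero,
    Nat.choose_eq_descFactorial_div_factorial]
  norm_num [Nat.descFactorial, Nat.factorial]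

/-- The bottom cell `k = 12`, `m = 34` (`d = 32`), by the fine bound. -/
theorem bottom_k12_d32 : phiK (2 + 32 + 10 + (10 + 2)) (2 + 32 + 10) ≤ rhat (2 + 32 + 10) (10 + 2) (2 + 32) := by
  apply phiK_le_rhat_bottom_of_fine 10 32 (by norm_num)
  simp only [Finset.sum_range_succ, Finset.sum_range_zero, Finset.prod_range_succ, Finset.prod_range_zero,
    Nat.choose_eq_descFactorial_div_factorial]
  norm_num [Nat.descFactorial, Nat.factorial]

/-- The bottom cell `k = 12`, `m = 35` (`d = 33`), by the fine bound. -/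
theorem bottom_k12_d33 : phiK (2 + 33 + 10 + (10 + 2)) (2 + 33 + 10) ≤ rhat (2 + 33 + 10) (10 + 2) (2 + 33) := by
  apply phiK_le_rhat_bottom_of_fine 10 33 (by norm_num)
  simp only [Finset.sum_range_succ, Finset.sum_range_zero, Finset.prod_range_succ, Finset.prod_range_zero,
    Nat.choose_eq_descFactorial_div_factorial]
  norm_num [Nat.descFactorial, Nat.factorial]

/-- The bottom cell `k = 12`, `m = 36` (`d = 34`), by the fine bound. -/
theorem bottom_k12_d34 : phiK (2 + 34 + 10 + (10 + 2)) (2 + 34 + 10) ≤ rhat (2 + 34 + 10) (10 + 2) (2 + 34) := by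
  apply phiK_le_rhat_bottom_of_fine 10 34 (by norm_num)
  simp only [Finset.sum_range_succ, Finset.sum_range_zero, Finset.prod_range_succ, Finset.prod_range_zero,
    Nat.choose_eq_descFactorial_div_factorial]
  norm_num [Nat.descFactorial, Nat.factorial]

/-- The bottom cell `k = 12`, `m = 37` (`d = 35`), by the fine bound. -/
theorem bottom_k12_d35 : phiK (2 + 35 + 10 + (10 + 2)) (2 + 35 + 10) ≤ rhat (2 + 35 + 10) (10 + 2) (2 + 35) := by
  apply phiK_le_rhat_bottom_of_fine 10 35 (by norm_num)
  simp only [Finset.sum_range_succ, Finset.sum_range_zero, Finset.prod_range_succ, Finset.prod_range_zero,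
    Nat.choose_eq_descFactorial_div_factorial]
  norm_num [Nat.descFactorial, Nat.factorial]

/-- The bottom cell `k = 12`, `m = 38` (`d = 36`), by the fine bound. -/
theorem bottom_k12_d36 : phiK (2 + 36 + 10 + (10 + 2)) (2 + 36 + 10) ≤ rhat (2 + 36 + 10) (10 + 2) (2 + 36) := by
  apply phiK_le_rhat_bottom_of_fine 10 36 (by norm_num)
  simp only [Finset.sum_range_succ, Finset.sum_range_zero, Finset.prod_range_succ, Finset.prod_range_zero,
    Nat.choose_eq_descFactorial_div_factorial]
  norm_num [Nat.descFactorial, Nat.factorial]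

/-- The bottom cell `k = 12`, `m = 39` (`d = 37`), by the fine bound. -/
theorem bottom_k12_d37 : phiK (2 + 37 + 10 + (10 + 2)) (2 + 37 + 10) ≤ rhat (2 + 37 + 10) (10 + 2) (2 + 37) := by
  apply phiK_le_rhat_bottom_of_fine 10 37 (by norm_num)
  simp only [Finset.sum_range_succ, Finset.sum_range_zero, Finset.prod_range_succ, Finset.prod_range_zero,
    Nat.choose_eq_descFactorial_div_factorial]
  norm_num [Nat.descFactorial, Nat.factorial]

/-- The bottom cell `k = 12`, `m = 40` (`d = 38`), by the fine bound. -/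
theorem bottom_k12_d38 : phiK (2 + 38 + 10 + (10 + 2)) (2 + 38 + 10) ≤ rhat (2 + 38 + 10) (10 + 2) (2 + 38) := by
  apply phiK_le_rhat_bottom_of_fine 10 38 (by norm_num)
  simp only [Finset.sum_range_succ, Finset.sum_range_zero, Finset.prod_range_succ, Finset.prod_range_zero,
    Nat.choose_eq_descFactorial_div_factorial]
  norm_num [Nat.descFactorial, Nat.factorial]

/-- The bottom cell `k = 12`, `m = 41` (`d = 39`), by the fine bound. -/
theorem bottom_k12_d39 : phiK (2 + 39 + 10 + (10 + 2)) (2 + 39 + 10) ≤ rhat (2 + 39 + 10) (10 + 2) (2 + 39) := by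
  apply phiK_le_rhat_bottom_of_fine 10 39 (by norm_num)
  simp only [Finset.sum_range_succ, Finset.sum_range_zero, Finset.prod_range_succ, Finset.prod_range_zero,
    Nat.choose_eq_descFactorial_div_factorial]
  norm_num [Nat.descFactorial, Nat.factorial]

/-- The bottom cell `k = 12`, `m = 42` (`d = 40`), by the fine bound. -/
theorem bottom_k12_d40 : phiK (2 + 40 + 10 + (10 + 2)) (2 + 40 + 10) ≤ rhat (2 + 40 + 10) (10 + 2) (2 + 40) := by
  apply phiK_le_rhat_bottom_of_fine 10 40 (by norm_num)
  simp only [Finset.sum_range_succ, Finset.sum_range_zero, Finset.prod_range_succ, Finset.prod_range_zero,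
    Nat.choose_eq_descFactorial_div_factorial]
  norm_num [Nat.descFactorial, Nat.factorial]

/-- The bottom cell `k = 12`, `m = 43` (`d = 41`), by the fine bound. -/
theorem bottom_k12_d41 : phiK (2 + 41 + 10 + (10 + 2)) (2 + 41 + 10) ≤ rhat (2 + 41 + 10) (10 + 2) (2 + 41) := by
  apply phiK_le_rhat_bottom_of_fine 10 41 (by norm_num)
  simp only [Finset.sum_range_succ, Finset.sum_range_zero, Finset.prod_range_succ, Finset.prod_range_zero,
    Nat.choose_eq_descFactorial_div_factorial]
  norm_num [Nat.descFactorial, Nat.factorial]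

/-- The remaining bottom cells of `k = 12`: `28 ≤ m ≤ 43` (`26 ≤ d ≤ 41`). -/
theorem bottom_k12_rest (d : ℕ) (h1 : 26 ≤ d) (h2 : d ≤ 41) :
    phiK (2 + d + 10 + (10 + 2)) (2 + d + 10) ≤ rhat (2 + d + 10) (10 + 2) (2 + d) := by
  interval_cases d
  · exact bottom_k12_d26
  · exact bottom_k12_d27
  · exact bottom_k12_d28
  · exact bottom_k12_d29
  · exact bottom_k12_d30
  · exact bottom_k12_d31
  · exact bottom_k12_d32
  · exact bottom_k12_d33
  · exact bottom_k12_d34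
  · exact bottom_k12_d35
  · exact bottom_k12_d36
  · exact bottom_k12_d37
  · exact bottom_k12_d38
  · exact bottom_k12_d39
  · exact bottom_k12_d40
  · exact bottom_k12_d41

/-- **THE WHOLE BOTTOM REGIME OF `k = 12` ABOVE THE IDENTITY CELL**: every `11 ≤ q ≤ 53` (`1 ≤ m ≤ 43`). -/
theorem bottom_k12_complete (q : ℕ) (h1 : 11 ≤ q) (h2 : q ≤ 53) : phiK (q + 12) q ≤ rhat q 12 (q - 10) := by
  rcases Nat.lt_or_ge q 13 with hq | hq
  · interval_cases q
    · exact rhatCell_one 11 12 (by omega) (by omega)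
    · have := phiK_le_rhat_flat_two 12 (by omega)
      rw [show 2 * 12 = 12 + 12 by ring] at this; exact this
  · obtain ⟨d, rfl⟩ : ∃ d, q = 2 + d + 10 := ⟨q - 12, by omega⟩
    rw [show 2 + d + 10 - 10 = 2 + d by omega, show 2 + d + 10 + 12 = 2 + d + 10 + (10 + 2) by ring]
    rcases Nat.lt_or_ge d 26 with hd | hd
    · exact bottom_k12_all d (by omega) (by omega)
    · exact bottom_k12_rest d hd (by omega)

end PercRepro
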